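import Summits.BirchSwinnertonDyer.BirchSwinnertonDyer.Theorems.ResidualThetaTransportAtTwoThetaLayerLambdaCongruenceAtTwoPeriodFactor
import Literature.NumberTheory.EllipticCurves.ModularFormsGamma0Genus
import HarnessLib

/-!
# Crux `ThetaLayerLambdaCongruenceAtTwo` (stmt-BirchSwinnertonDyer-20688, route ResidualThetaTransportAtTwo), line
# `birth` v13 — SD floor at `ℓ = 2`, brick S3 (part 1): a MANIN-SYMBOL SYSTEM on `Γ₀(N)\SL₂(ℤ)` killing the elliptic cosets
# defines an additive map on the period lattice `H₁(X₀(N), ℤ)` by chain sums; boundary systems give `0` (width seat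
# bsd-wall-rtt-p3-w2 g8; `--supports stmt-BirchSwinnertonDyer-20688 --as helper`; closes nothing)

HONEST FRAMING. THEOREMS only, about functions `M : SL₂(ℤ)/Γ₀(N) → R` in the EXACT currency of `…ManinSymbolTorsion` /
`…PeriodFactor` (the coset space `Gamma0Coset N` with `S • q`, `(T S) • q`; chains `Σ_{g∈L} M(g⁻¹Γ₀(N))` of
`…ManinChain`); the genus formula enters through the tree's THEOREM `twelve_mul_finrank_cuspForm_two_gamma0_holds`. No
definition; nothing about any curve or form is asserted; BSD is not proved by any of this.

WHAT. `R` an additive group without `3`-torsion; `M : Gamma0Coset N → R` a MANIN SYSTEM killing the elliptic cosets: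
(i) `M(S·q) = −M(q)`, (ii) `M(q) + M(TS·q) + M((TS)²·q) = 0`, (iii) `M(q) = 0` if `S·q = q`, (iv) `M(q) = 0` if `TS·q = q`
(= a mod-anything `1`-CYCLE on the dual graph of the Farey tessellation of `X₀(N)`: edges = free `S`-orbits, vertices = `TS`-orbits).
* §1 `maninSystem_chainSum_eq_zero_of_periodFunctionals_eq_zero`: for Manin chains `Lᵢ` of `γᵢ ∈ Γ₀(N)` (the universal chains of
  `…ManinChain`, given as hypotheses) and integers `nᵢ` with `Σ nᵢ·{∞, γᵢ∞} = 0` in `S₂(Γ₀(N))^∨`: `Σᵢ nᵢ · Σ_{g∈Lᵢ} M(g⁻¹Γ₀(N)) = 0`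
  — the second half of `…PeriodFactor.periods_eq_zero_of_periodFunctionals_eq_zero`, cut loose from symbol functions.
* §2 `exists_addMonoidHom_periodHomology_of_maninSystem`: hence `M` defines an additive `φ_M : Λ → R`, `Λ = periodHomology N`, with
  `φ_M({∞, k∞}) = Σ_{g∈L} M(g⁻¹Γ₀(N))` for EVERY chain `L` of EVERY `k ∈ Γ₀(N)` — the pairing «dual-graph cycle × Farey cycle» of
  the sign-free architecture `Cruxes/…/Lines/birth-sd2-architecture.md` (dual model `→ Hom(Λ, R)`).
* §3 `boundarySystem_chainSum_eq_zero`: a BOUNDARY system `M(g⁻¹Γ₀(N)) = ψ[g∞] − ψ[g0]` (`ψ` any function on the cusp classes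
  `CuspOrbits Γ₀(N)`, `[·]` = `cuspOrbitOf N`) has all closed chain sums `0`, so `φ_M = 0` — the cusp loops die in `H₁(X₀(N))`.
The companion `…ManinSystemDualModel` proves the converse of §3 and the surjectivity of `M ↦ φ_M` (every `φ : Λ → R` is a `φ_M`):
together `Hom(Λ, R) ≅ {Manin systems killing elliptic cosets}/{boundary systems}` — Lefschetz duality for `X₀(N)` with coefficients
in `R`, from coset data only (brick S3).

References: [Manin1972] §1.5–1.7, Thm. 1.6, Thm. 1.9; [CremonaAlgorithms1997] §2.1–2.2; Wiese, Computational arithmetic of modular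
forms (in [InamBuyukasik2019]) Prop. 5.1, Thm. 5.7.
-/

set_option autoImplicit false

noncomputable section

-- justification: the `Summit.BirchSwinnertonDyer.BirchSwinnertonDyer.…` path repeats a component (route-file convention)
set_option linter.dupNamespace false

open scoped Classical MatrixGroups

open CongruenceSubgroup Matrix.SpecialLinearGroup ModularGroup
open Literature.NumberTheory.EllipticCurves.ModularForms

namespace Summit.BirchSwinnertonDyer.BirchSwinnertonDyer.Theorems.ThetaLayerLambdaCongruenceAtTwo

/-! ## §1. Chain sums of a Manin system respect the relations among period functionals -/

section ChainSum

variable {R : Type} [AddCommGroup R] {N : ℕ} [NeZero N]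

/-- **Relations among period functionals hold among the chain sums of a Manin system killing the elliptic cosets.**
`R` without `3`-torsion, `M : Gamma0Coset N → R` with (i)–(iv); `Lᵢ` Manin chains of `γᵢ ∈ Γ₀(N)` (universal property of
`…ManinChain.exists_maninChain`). If `Σ nᵢ·{∞, γᵢ∞} = 0` in `S₂(Γ₀(N))^∨` then `Σ nᵢ·Σ_{g∈Lᵢ} M(g⁻¹Γ₀(N)) = 0`. Proof = the
integral half of Manin's theorem as organised in `…PeriodFactor`: `c = Σ nᵢ chainVec(Lᵢ)` is an integral cycle with `Ψ(c) = 0`, hence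
(exactness over `ℚ`, `ker_msymbolMap_inf_ker_bdryMap_eq_relModule` with the genus theorem) a rational relation, and the torsion lemma
`sum_smul_eq_zero_of_mul_eq_relation` applies. [cite: Manin1972, Thm. 1.9] -/
theorem maninSystem_chainSum_eq_zero_of_periodFunctionals_eq_zero (M : Gamma0Coset N → R)
    (hM1 : ∀ q, M (S • q) = -M q)
    (hM2 : ∀ q, M q + M ((T * S) • q) + M ((T * S) • (T * S) • q) = 0)
    (hM3 : ∀ q, S • q = q → M q = 0) (hM4 : ∀ q, (T * S) • q = q → M q = 0)
    (h3 : ∀ r : R, r + r + r = 0 → r = 0)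
    {ι : Type} [Fintype ι] (n : ι → ℤ) (γ : ι → Gamma0 N) (L : ι → List SL(2, ℤ))
    (hL : ∀ i, ∀ {A : Type} [AddCommGroup A] (F : SL(2, ℤ) → A),
      (∀ g, F (g * T) = F g) → (∀ g, F (-g) = F g) →
        ((L i).map fun g ↦ F g - F (g * S)).sum = F ((γ i : Gamma0 N) : SL(2, ℤ)) - F 1)
    (hrel : ∑ i, n i • periodFunctional N (γ i) = 0) :
    ∑ i, n i • ((L i).map fun g ↦ M ((g⁻¹ : SL(2, ℤ)) : Gamma0Coset N)).sum = 0 := by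
  have hgenus : twelve_mul_finrank_cuspForm_two (Gamma0 N) := twelve_mul_finrank_cuspForm_two_gamma0_holds N
  -- the integral chain `cZ = Σ nᵢ · chainVec (L i)` and its pairing identity
  set cZ : Gamma0Coset N → ℤ := fun q ↦
    ∑ i, n i * ((L i).map fun g ↦ (Pi.single ((g⁻¹ : SL(2, ℤ)) : Gamma0Coset N) (1 : ℤ) : Gamma0Coset N → ℤ)).sum q
    with hcZ
  have pair : ∀ {V : Type} [AddCommGroup V] (v : Gamma0Coset N → V),
      ∑ q, cZ q • v q = ∑ i, n i • ((L i).map fun g ↦ v ((g⁻¹ : SL(2, ℤ)) : Gamma0Coset N)).sum := by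
    intro V _ v
    simp only [hcZ, Finset.sum_smul, mul_smul]
    rw [Finset.sum_comm]
    refine Finset.sum_congr rfl fun i _ ↦ ?_
    rw [← sum_chainVec_smul v (L i), Finset.smul_sum]
  -- the rational chain `c`
  set c : Gamma0Coset N → ℚ := fun q ↦ (cZ q : ℚ) with hc
  have pairQ : ∀ {V : Type} [AddCommGroup V] [Module ℚ V] (v : Gamma0Coset N → V),
      ∑ q, c q • v q = ∑ i, n i • ((L i).map fun g ↦ v ((g⁻¹ : SL(2, ℤ)) : Gamma0Coset N)).sum := by
    intro V _ _ v
    rw [← pair v]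
    exact Finset.sum_congr rfl fun q _ ↦ Int.cast_smul_eq_zsmul ℚ (cZ q) (v q)
  -- `Ψ(c) = Σ nᵢ {∞, γᵢ∞} = 0`
  have hΨ : msymbolMap N c = 0 := by
    have e : msymbolMap N c = ∑ q, c q • msymbol N q := by
      rw [msymbolMap, Fintype.linearCombination_apply]
    rw [e, pairQ (msymbol N)]
    have e3 : ∀ i, ((L i).map fun g ↦ msymbol N ((g⁻¹ : SL(2, ℤ)) : Gamma0Coset N)).sum =
        periodFunctional N (γ i) := fun i ↦ by
      rw [periodFunctional_eq_inftyFunctional, ← maninChain_sum_msymbolFunctional (hL i)]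
      congr 1
      refine List.map_congr_left fun g _ ↦ ?_
      rw [msymbol_mk, inv_inv]
    simp_rw [e3]
    exact hrel
  -- `δ(c) = Σ nᵢ ([γᵢ∞] − [∞]) = 0`
  have hδ : bdryMap N c = 0 := by
    have e : bdryMap N c = ∑ q, c q • bdryVec N q := by
      rw [bdryMap, Fintype.linearCombination_apply]
    rw [e, pairQ (bdryVec N)]
    have e3 : ∀ i, ((L i).map fun g ↦ bdryVec N ((g⁻¹ : SL(2, ℤ)) : Gamma0Coset N)).sum = 0 := fun i ↦ by
      have hb : ∀ g : SL(2, ℤ), bdryVec N ((g⁻¹ : SL(2, ℤ)) : Gamma0Coset N) =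
          Pi.single (cuspOrbitOf N g) (1 : ℚ) - Pi.single (cuspOrbitOf N (g * S)) 1 := fun g ↦ by
        rw [bdryVec, cuspInfty_mk, inv_inv, MulAction.Quotient.smul_mk, smul_eq_mul, cuspInfty_mk, mul_inv_rev,
          inv_inv, inv_inv]
      simp_rw [hb]
      rw [maninChain_sum_cuspOrbitOf (hL i), ← mul_one ((γ i : Gamma0 N) : SL(2, ℤ)),
        cuspOrbitOf_mul_of_mem (γ i).2, sub_self]
    simp_rw [e3, smul_zero, Finset.sum_const_zero]
  -- exactness over `ℚ`: `c ∈ Rel`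
  have hcRel : c ∈ relModule N := by
    rw [← ker_msymbolMap_inf_ker_bdryMap_eq_relModule N hgenus]
    exact ⟨LinearMap.mem_ker.mpr hΨ, LinearMap.mem_ker.mpr hδ⟩
  obtain ⟨y, hy, z, hz, hyz⟩ := Submodule.mem_sup.mp hcRel
  obtain ⟨u, rfl⟩ := LinearMap.mem_range.mp hy
  obtain ⟨v, rfl⟩ := LinearMap.mem_range.mp hz
  -- clear denominators
  set D : ℕ := ∏ q, ((u q).den * (v q).den) with hD
  have hD0 : D ≠ 0 := Finset.prod_ne_zero_iff.mpr fun q _ ↦ mul_ne_zero (u q).den_nz (v q).den_nz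
  have hdu : ∀ q, (u q).den ∣ D := fun q ↦
    (Dvd.intro _ rfl : (u q).den ∣ (u q).den * (v q).den).trans (Finset.dvd_prod_of_mem _ (Finset.mem_univ q))
  have hdv : ∀ q, (v q).den ∣ D := fun q ↦
    (Dvd.intro_left _ rfl : (v q).den ∣ (u q).den * (v q).den).trans (Finset.dvd_prod_of_mem _ (Finset.mem_univ q))
  choose uZ huZ using fun q ↦ exists_int_cast_eq_natCast_mul (u q) D (hdu q)
  choose vZ hvZ using fun q ↦ exists_int_cast_eq_natCast_mul (v q) D (hdv q)
  have hSS : ∀ q : Gamma0Coset N, S • S • q = q := fun q ↦ by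
    rw [← mul_smul, S_mul_S_eq_neg_one, neg_one_smul_coset]
  have hTS3 : ∀ q : Gamma0Coset N, (T * S) • (T * S) • (T * S) • q = q := fun q ↦ by
    rw [← mul_smul, ← mul_smul, TS_pow_three_eq, neg_one_smul_coset]
  set AZ : Gamma0Coset N → ℤ := fun q ↦ uZ q + uZ (S • q) with hAZ'
  set BZ : Gamma0Coset N → ℤ := fun q ↦ vZ q + vZ ((T * S) • q) + vZ ((T * S) • (T * S) • q) with hBZ'
  have hAZ : ∀ q, AZ (S • q) = AZ q := fun q ↦ by
    show uZ (S • q) + uZ (S • S • q) = uZ q + uZ (S • q)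
    rw [hSS, add_comm]
  have hBZ : ∀ q, BZ ((T * S) • q) = BZ q := fun q ↦ by
    show vZ ((T * S) • q) + vZ ((T * S) • (T * S) • q) + vZ ((T * S) • (T * S) • (T * S) • q) =
      vZ q + vZ ((T * S) • q) + vZ ((T * S) • (T * S) • q)
    rw [hTS3]; abel
  have hrelZ : ∀ q, (D : ℤ) * cZ q = AZ q + BZ q + 0 := fun q ↦ by
    have e := congrFun hyz q
    have e' : c q = (u q + u (S • q)) + (v q + v ((T * S) • q) + v ((T * S) • (T * S) • q)) := by
      rw [← e]
      simp only [relTwo, relThree, Pi.add_apply, LinearMap.add_apply, LinearMap.id_apply, LinearMap.comp_apply,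
        cosetPerm_apply]
    apply Int.cast_injective (α := ℚ)
    rw [add_zero]
    push_cast
    rw [show ((cZ q : ℤ) : ℚ) = c q from rfl, e', show ((AZ q : ℤ) : ℚ) = (uZ q : ℚ) + (uZ (S • q) : ℚ) by
      simp only [hAZ']; push_cast; rfl, show ((BZ q : ℤ) : ℚ) = (vZ q : ℚ) + (vZ ((T * S) • q) : ℚ) +
      (vZ ((T * S) • (T * S) • q) : ℚ) by simp only [hBZ']; push_cast; rfl, huZ, huZ, hvZ, hvZ, hvZ]
    ring
  -- the torsion lemma
  have key := sum_smul_eq_zero_of_mul_eq_relation (X := Gamma0Coset N) (fun q ↦ S • q) (fun q ↦ (T * S) • q)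
    hSS hTS3 M hM1 hM2 hM3 hM4 h3 cZ AZ BZ (fun _ ↦ 0) (D : ℤ) (by exact_mod_cast hD0) hAZ hBZ
    (fun q h ↦ (h rfl).elim) hrelZ
  rw [pair M] at key
  exact key

end ChainSum

/-! ## §2. The additive map `φ_M : Λ → R` of a Manin system -/

section Factor

variable {R : Type} [AddCommGroup R] {N : ℕ} [NeZero N]

/-- **A Manin system killing the elliptic cosets defines an additive map on the period lattice** `Λ = H₁(X₀(N), ℤ) ⊂ S₂(Γ₀(N))^∨`
by chain sums: there is `φ_M : Λ →+ R` with `φ_M({∞, k∞}) = Σ_{g∈L} M(g⁻¹Γ₀(N))` for EVERY Manin chain `L` of EVERY `k ∈ Γ₀(N)` (in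
particular chain sums of closed chains are chain-independent). This is the pairing of the dual-graph `1`-cycle `M` with the Farey
cycle of `k` — the map «dual model `→ Hom(Λ, R)`» of Lefschetz duality, from coset data. [cite: Manin1972, Thm. 1.9] -/
theorem exists_addMonoidHom_periodHomology_of_maninSystem (M : Gamma0Coset N → R)
    (hM1 : ∀ q, M (S • q) = -M q)
    (hM2 : ∀ q, M q + M ((T * S) • q) + M ((T * S) • (T * S) • q) = 0)
    (hM3 : ∀ q, S • q = q → M q = 0) (hM4 : ∀ q, (T * S) • q = q → M q = 0)
    (h3 : ∀ r : R, r + r + r = 0 → r = 0) :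
    ∃ φ : periodHomology N →+ R, ∀ (k : Gamma0 N) (L : List SL(2, ℤ)),
      (∀ {A : Type} [AddCommGroup A] (F : SL(2, ℤ) → A), (∀ g, F (g * T) = F g) → (∀ g, F (-g) = F g) →
        (L.map fun g ↦ F g - F (g * S)).sum = F (k : SL(2, ℤ)) - F 1) →
      φ ⟨periodFunctional N k, periodFunctional_mem_periodHomology N k⟩ =
        (L.map fun g ↦ M ((g⁻¹ : SL(2, ℤ)) : Gamma0Coset N)).sum := by
  -- every element of `Λ` is a single period functional; choose one and a chain for it
  have hsurj : ∀ x : periodHomology N, ∃ γ : Gamma0 N, periodFunctional N γ = (x : Module.Dual ℂ (CuspForm (Gamma0 N) 2)) :=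
    fun x ↦ by
      have hx : (x : Module.Dual ℂ (CuspForm (Gamma0 N) 2)) ∈ (periodHomology N : Set (Module.Dual ℂ (CuspForm (Gamma0 N) 2))) :=
        x.2
      rw [coe_periodHomology_eq_range] at hx
      exact hx
  choose sec hsec using hsurj
  choose ch hch using fun γ : Gamma0 N ↦ exists_maninChain.{0} (γ : SL(2, ℤ))
  let val : Gamma0 N → R := fun γ ↦ ((ch γ).map fun g ↦ M ((g⁻¹ : SL(2, ℤ)) : Gamma0Coset N)).sum
  -- chain sums only depend on the period functional (two-index relation)
  have hwd : ∀ (γ δ : Gamma0 N) (L : List SL(2, ℤ)),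
      (∀ {A : Type} [AddCommGroup A] (F : SL(2, ℤ) → A), (∀ g, F (g * T) = F g) → (∀ g, F (-g) = F g) →
        (L.map fun g ↦ F g - F (g * S)).sum = F (δ : SL(2, ℤ)) - F 1) →
      periodFunctional N γ = periodFunctional N δ →
      val γ = (L.map fun g ↦ M ((g⁻¹ : SL(2, ℤ)) : Gamma0Coset N)).sum := by
    intro γ δ L hL h
    have hrel : ∑ i : Fin 2, (![1, -1] i) • periodFunctional N (![γ, δ] i) = 0 := by
      rw [Fin.sum_univ_two]; simp [h]
    have key := maninSystem_chainSum_eq_zero_of_periodFunctionals_eq_zero M hM1 hM2 hM3 hM4 h3 (ι := Fin 2)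
      (![1, -1]) (![γ, δ]) (![ch γ, L]) (fun i ↦ by
      fin_cases i
      · exact fun F hT hn ↦ hch γ F hT hn
      · exact fun F hT hn ↦ hL F hT hn) hrel
    rw [Fin.sum_univ_two] at key
    simp only [Matrix.cons_val_zero, Matrix.cons_val_one, one_smul, neg_smul] at key
    exact sub_eq_zero.mp (by rw [sub_eq_add_neg]; exact key)
  refine ⟨{ toFun := fun x ↦ val (sec x), map_zero' := ?_, map_add' := ?_ }, ?_⟩
  · -- `per (sec 0) = 0`: the one-index relation
    show val (sec 0) = 0
    have hrel : ∑ i : Fin 1, (![1] i) • periodFunctional N (![sec 0] i) = 0 := by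
      rw [Fin.sum_univ_one]; simp [hsec]
    have key := maninSystem_chainSum_eq_zero_of_periodFunctionals_eq_zero M hM1 hM2 hM3 hM4 h3 (ι := Fin 1)
      (![1]) (![sec 0]) (![ch (sec 0)]) (fun i ↦ by
      fin_cases i; exact fun F hT hn ↦ hch (sec 0) F hT hn) hrel
    rw [Fin.sum_univ_one] at key
    simpa using key
  · intro x y
    show val (sec (x + y)) = val (sec x) + val (sec y)
    -- the chain `ch (sec x) ++ (sec x) • ch (sec y)` computes `per (sec x * sec y) = per (sec (x + y))`
    have hL : ∀ {A : Type} [AddCommGroup A] (F : SL(2, ℤ) → A), (∀ g, F (g * T) = F g) → (∀ g, F (-g) = F g) →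
        ((ch (sec x) ++ (ch (sec y)).map fun g ↦ (sec x : SL(2, ℤ)) * g).map fun g ↦ F g - F (g * S)).sum =
          F ((sec x * sec y : Gamma0 N) : SL(2, ℤ)) - F 1 := by
      intro A _ F hT hn
      rw [List.map_append, List.sum_append, hch (sec x) F hT hn, List.map_map]
      have h2 := hch (sec y) (fun g ↦ F ((sec x : SL(2, ℤ)) * g)) (fun g ↦ by rw [← mul_assoc, hT])
        (fun g ↦ by simp only [mul_neg, hn])
      simp only [mul_one] at h2
      rw [show ((ch (sec y)).map ((fun g ↦ F g - F (g * S)) ∘ fun g ↦ (sec x : SL(2, ℤ)) * g)).sum =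
        ((ch (sec y)).map fun g ↦ F ((sec x : SL(2, ℤ)) * g) - F ((sec x : SL(2, ℤ)) * (g * S))).sum from by
          congr 1; exact List.map_congr_left fun g _ ↦ by simp [mul_assoc], h2, Subgroup.coe_mul]
      abel
    have h := hwd (sec (x + y)) (sec x * sec y) _ hL (by
      rw [periodFunctional_mul, hsec, hsec, hsec]; rfl)
    rw [h, List.map_append, List.sum_append, List.map_map]
    congr 1
    refine congrArg List.sum (List.map_congr_left fun g _ ↦ ?_)
    show M (((((sec x : SL(2, ℤ)) * g)⁻¹ : SL(2, ℤ)) : Gamma0Coset N)) = M ((g⁻¹ : SL(2, ℤ)) : Gamma0Coset N)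
    congr 1
    rw [mul_inv_rev, QuotientGroup.eq]
    simp
  · intro k L hL
    show val (sec _) = _
    exact hwd _ k L hL (by rw [hsec])

end Factor

/-! ## §3. Boundary systems have vanishing closed chain sums -/

section Boundary

variable {R : Type} [AddCommGroup R] {N : ℕ} [NeZero N]

/-- **Cusp loops die in `H₁(X₀(N))`**: for a BOUNDARY system `M(g⁻¹Γ₀(N)) = ψ[g∞] − ψ[g0]` (`ψ` any function on the cusp classes,
`[g0] = [gS∞]`), every closed chain sum vanishes: `Σ_{g∈L} M(g⁻¹Γ₀(N)) = ψ[k∞] − ψ[∞] = 0` for a chain `L` of `k ∈ Γ₀(N)` (the universal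
chain property applied to `F = ψ ∘ [·∞]`, which is `T`- and sign-invariant). Hence `φ_M = 0` in §2. [cite: Manin1972, Thm. 1.6] -/
theorem boundarySystem_chainSum_eq_zero (ψ : CuspOrbits (Gamma0 N : Subgroup (GL (Fin 2) ℝ)) → R)
    (k : Gamma0 N) (L : List SL(2, ℤ))
    (hL : ∀ {A : Type} [AddCommGroup A] (F : SL(2, ℤ) → A), (∀ g, F (g * T) = F g) → (∀ g, F (-g) = F g) →
      (L.map fun g ↦ F g - F (g * S)).sum = F (k : SL(2, ℤ)) - F 1) :
    (L.map fun g ↦ ψ (cuspOrbitOf N g) - ψ (cuspOrbitOf N (g * S))).sum = 0 := by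
  rw [hL (fun g ↦ ψ (cuspOrbitOf N g)) (fun g ↦ by rw [← zpow_one T, cuspOrbitOf_mul_T_zpow])
    (fun g ↦ by rw [cuspOrbitOf_neg]), ← mul_one (k : SL(2, ℤ)), cuspOrbitOf_mul_of_mem k.2, sub_self]

end Boundary

end Summit.BirchSwinnertonDyer.BirchSwinnertonDyer.Theorems.ThetaLayerLambdaCongruenceAtTwo

end
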